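import Summits.HubbardSuperconductivity.HubbardSuperconductivity.Theorems.AnisotropyChordTransferGapMonotone

/-!
# Route `AnisotropyChord` / H0 rotor rung, route (1): PART N20 — GM₂, THE TWO-MAGNON CASE OF CONJECTURE GM
# (theory seat `hubbard-h0-rotor-theory-1`, generation 18, cycle 18, memo ROTOR-THEORY-18 §216–§222; THEOREMS M56–M60)

CONJECTURE GM (PartN19, `AnisotropyGapMonotone` / `GapDominatesFerro`) says the full sector gap of
`H(Δ) = −Σ_b [½(S⁺S⁻ + h.c.) + Δ SᶻSᶻ]` on the `L×L` torus is non-increasing in `Δ ∈ [Δ₀, 1]`.  This file types its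
TWO-MAGNON case (`n = L²/2 + M = 2` particles, `M = 2 − L²/2`), which the cycle-18 memo reduces to an explicit pair of
finite lattice-sum inequalities via the Krein (rank-3) resolvent formula for the relative-coordinate problem
`h_K = −Σ_{±x} c_x T − Σ_{±y} c_y T − Δ·𝟙_shell` on the punctured twisted torus (`c_i = cos(K_i/2)`), sector by sector:

* `TwoMagnonGapDominatesFerro` (GM₂, endpoint form): `γ₂(Δ, L) ≥ γ₂(1, L) = 1 − cos(2π/L)` for `Δ ∈ [0,1]`, `L ≥ 3`;
* `TwoMagnonGapMonotone` (GM₂, monotone form);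
* `TwoMagnonFerroGap`: the SEP value at `Δ = 1` (for `n = 2` elementary: `h_0(1) = −4 + Laplacian(T_L ∖ 0)`);
* `twoMagnonGapDominatesFerro_of_monotone`: monotone form + ferro value ⇒ endpoint form;
* `classOrdering_ineq` (PROVED): `1 + cos²(π/L) < (1 − cos²(π/L))(L² − 2)` for `L ≥ 3` — the arithmetic core of the
  CLASS-ORDERING LEMMA M56 (in the sector `K₁ = (2π/L, 0)` the bosonic class `(+,+)` lies strictly below the class `(−,−)`,
  whose functions vanish on the row and column through the origin and therefore have the free energy `−2c² − 2cos(2π/L)`);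
* `XYTwoMagnonScreening` (typed, OPEN as a Lean theorem; numerically certified `3 ≤ L ≤ 512`, kit j326114): the explicit
  lattice-sum inequality `g₁(L; τ₀) ≤ 2·g₀(L; 0)` to which GM₂ (endpoint form) AT THE XY POINT `Δ = 0` reduces
  (memo §220: `δ₁ ≥ δ₀ ⟺ Φ₁(t₀) ≥ 0`, `Φ₁` strictly decreasing, `t₀ ≤ τ₀ := 1/(L² g₀)`).
-/

set_option linter.dupNamespace false
set_option autoImplicit false

noncomputable section

open Finset Filter Topology
open Literature.MathematicalPhysics.QuantumLattice Literature.Probability.LatticeModels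
open Summit.HubbardSuperconductivity.HubbardSuperconductivity.Theorems.AnisotropyChord.InsertionEntropy
open Summit.HubbardSuperconductivity.HubbardSuperconductivity.Theorems.AnisotropyChord.Tower
open Summit.HubbardSuperconductivity.HubbardSuperconductivity.Theorems.AnisotropyChord

namespace Summit.HubbardSuperconductivity.HubbardSuperconductivity.Theorems.AnisotropyChord.Transfer

/-- the two-magnon sector label `M = 2 − L²/2` (`n = L²/2 + M = 2` particles, PartN19's dictionary). [folklore] -/
def twoMagnonM (L : ℕ) : ℝ := 2 - (L : ℝ) ^ 2 / 2

/-- the one-magnon gap `ε₁(L) = 1 − cos(2π/L)` (= the SEP gap of the torus in every sector). [folklore] -/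
def oneMagnonGap (L : ℕ) : ℝ := 1 - Real.cos (2 * Real.pi / (L : ℝ))

/-- **GM₂ — endpoint form:** for `L ≥ 3` and `Δ ∈ [0, 1]` the full gap of `H(Δ)` in the two-magnon sector is at least the
one-magnon gap `1 − cos(2π/L)` (its exact value at `Δ = 1`).
[conjecture: theory seat hubbard-h0-rotor-theory-1, cycle 18 — PROVED ON PAPER FOR ALL `L ≥ 3` (memo ROTOR-THEORY-18 §222,
THEOREM GM₂-END: exact Krein reduction to the η-free certificate (P1_L),(P2_L) + level ordering; analytic for `L ≥ 32`,
interval-certified for every `4 ≤ L ≤ 256` (kit j326481), exact rationals at `L = 3` (kit j326391)); the tag stays because the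
finite trigonometric-sum estimates are not ported to Lean] -/
@[conjecture] def TwoMagnonGapDominatesFerro : Prop :=
  ∀ L : ℕ, 3 ≤ L → ∀ [NeZero L], ∀ Δ : ℝ, 0 ≤ Δ → Δ ≤ 1 →
    SectorGapAtLeast L Δ (twoMagnonM L) (oneMagnonGap L)

/-- **GM₂ — monotone form:** for `L ≥ 3` the two-magnon sector gap is non-increasing in `Δ` on `[0, 1]`
(Hellmann–Feynman: `⟨𝟙_shell⟩` in the `K₁` ground state ≥ in the `K = 0` ground state).
[conjecture: theory seat hubbard-h0-rotor-theory-1, cycle 18, memo §221/§223; numerically `P₁/P₀ ∈ [1.30, 2.006]` for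
3 ≤ L ≤ 512 (kit j326114); interval-CERTIFIED on `(0,1]` for `L = 3…8` (kit j326644); OPEN for all `L`] -/
@[conjecture] def TwoMagnonGapMonotone : Prop :=
  ∀ L : ℕ, 3 ≤ L → ∀ [NeZero L], ∀ Δ Δ' g : ℝ, 0 ≤ Δ → Δ ≤ Δ' → Δ' ≤ 1 →
    SectorGapAtLeast L Δ' (twoMagnonM L) g → SectorGapAtLeast L Δ (twoMagnonM L) g

/-- **the ferromagnetic-point value:** at `Δ = 1` the two-magnon sector gap is `≥ 1 − cos(2π/L)` (the `K = 0` relative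
Hamiltonian is `−4 + Laplacian` of the punctured torus and the `K₁` threshold state `cos(π r_x/L)` is exact; special case of
PartN19's `FerroSectorGapCLR`). [conjecture: support statement, provable (memo §218 LEMMA B); n = 2 case of
Caputo–Liggett–Richthammer 2010 Thm 1.1] -/
@[conjecture] def TwoMagnonFerroGap : Prop :=
  ∀ L : ℕ, 3 ≤ L → ∀ [NeZero L], SectorGapAtLeast L 1 (twoMagnonM L) (oneMagnonGap L)

/-- the ferromagnetic value is the `M = 2 − L²/2` instance of PartN19's named hypothesis `FerroSectorGapCLR`. [folklore] -/
theorem twoMagnonFerroGap_of_CLR (h : FerroSectorGapCLR) : TwoMagnonFerroGap :=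
  fun L hL _ => h L hL (twoMagnonM L)

/-- monotone form + ferromagnetic value ⇒ endpoint form. [folklore] -/
theorem twoMagnonGapDominatesFerro_of_monotone (hF : TwoMagnonFerroGap) (hM : TwoMagnonGapMonotone) :
    TwoMagnonGapDominatesFerro := by
  intro L hL _ Δ h0 h1
  exact hM L hL Δ 1 (oneMagnonGap L) h0 h1 le_rfl (hF L hL)

/-- **LEMMA M56 (class ordering), arithmetic core:** `1 + cos²(π/L) < (1 − cos²(π/L))·(L² − 2)` for `L ≥ 3`
(Jordan `sin(π/L) ≥ 2/L`, so the right side is `≥ 4 − 8/L² ≥ 28/9 > 2`).  With `V = L²` it is the strict inequality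
`−2 − 2c² + (2 + 2c²)/(V/2 − 1) < −2c² − 2cos(2π/L)` between the `(+,+)` test energy and the exact `(−,−)` energy in the
sector `K₁`. [folklore] -/
theorem classOrdering_ineq {L : ℕ} (hL : 3 ≤ L) :
    1 + Real.cos (Real.pi / (L : ℝ)) ^ 2 < (1 - Real.cos (Real.pi / (L : ℝ)) ^ 2) * ((L : ℝ) ^ 2 - 2) := by
  have hL3 : (3 : ℝ) ≤ (L : ℝ) := by exact_mod_cast hL
  have hLpos : (0 : ℝ) < (L : ℝ) := by linarith
  -- Jordan: 2/L ≤ sin(π/2 · 2/L) = sin(π/L)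
  have hs : 2 / (L : ℝ) ≤ Real.sin (Real.pi / (L : ℝ)) := by
    have h := Real.le_sin_mul (x := 2 / (L : ℝ)) (by positivity) (by rw [div_le_one hLpos]; linarith)
    have e : Real.pi / 2 * (2 / (L : ℝ)) = Real.pi / (L : ℝ) := by field_simp
    rwa [e] at h
  have hsq : 1 - Real.cos (Real.pi / (L : ℝ)) ^ 2 = Real.sin (Real.pi / (L : ℝ)) ^ 2 := by
    rw [Real.sin_sq]
  rw [hsq]
  have h0 : (0 : ℝ) ≤ 2 / (L : ℝ) := by positivity
  have h4 : (2 / (L : ℝ)) ^ 2 ≤ Real.sin (Real.pi / (L : ℝ)) ^ 2 := pow_le_pow_left₀ h0 hs 2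
  have hL2 : (0 : ℝ) ≤ (L : ℝ) ^ 2 - 2 := by nlinarith
  have key : (2 / (L : ℝ)) ^ 2 * ((L : ℝ) ^ 2 - 2) ≤ Real.sin (Real.pi / (L : ℝ)) ^ 2 * ((L : ℝ) ^ 2 - 2) :=
    mul_le_mul_of_nonneg_right h4 hL2
  have e2 : (2 / (L : ℝ)) ^ 2 * ((L : ℝ) ^ 2 - 2) = 4 - 8 / (L : ℝ) ^ 2 := by
    field_simp; ring
  have h89 : 8 / (L : ℝ) ^ 2 ≤ 8 / 9 := by
    apply div_le_div_of_nonneg_left (by norm_num) (by norm_num) (by nlinarith)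
  rw [e2] at key
  nlinarith [sq_nonneg (Real.sin (Real.pi / (L : ℝ))), hsq, key, h89]

/-! ## The XY-point screening inequality (memo §220: END-INEQ at `Δ = 0`)

With `V = L²`, `a_j = 1 − cos(2πj/L)`, `b_k = 1 − cos(2πk/L)`, `c = cos(π/L)`, `a'_j = c − cos((2j+1)π/L) ≥ 0`:
`g₀(t) = V⁻¹ Σ_{(j,k) ≠ (0,0)} (2a_j + 2b_k − t)⁻¹` (regular part at the origin of the free `K = 0` two-magnon resolvent) and
`g₁(t) = V⁻¹ Σ_{(j,k) ∉ {(0,0),(L−1,0)}} (2c·a'_j + 2b_k − t)⁻¹` (the same for `K₁ = (2π/L, 0)`: antiperiodic momenta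
`(2j+1)π/L` in the `x`-direction, hopping `c`).  At `Δ = 0` the `(+,+)` sector ground energies are `b_K + t_K` with
`t_K · g_K(t_K) = ν_K`, `ν₀ = 1/V`, `ν₁ = 2/V` (Krein / rank-one formula for the hard core), and
`γ₂(0, L) ≥ ε₁(L) ⟺ t₁ ≥ t₀ ⟸ g₁(τ₀) ≤ 2 g₀(0)` with `τ₀ := 1/(V g₀(0)) ≥ t₀` (both `g_K` increase in `t`). -/

/-- `g₀(L; t)`: regular part at the origin of the free two-magnon resolvent in the sector `K = 0`
(`(1/2π) ln L + O(1)`). [folklore] -/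
def gZero (L : ℕ) (t : ℝ) : ℝ :=
  ((L : ℝ) ^ 2)⁻¹ * ∑ j ∈ Finset.range L, ∑ k ∈ Finset.range L,
    if j = 0 ∧ k = 0 then 0 else
      (2 * (1 - Real.cos (2 * Real.pi * j / L)) + 2 * (1 - Real.cos (2 * Real.pi * k / L)) - t)⁻¹

/-- `g₁(L; t)`: the same in the sector `K₁ = (2π/L, 0)` (antiperiodic `x`-momenta, `x`-hopping `cos(π/L)`; the two bottom
momenta `j ∈ {0, L−1}, k = 0` removed). [folklore] -/
def gOne (L : ℕ) (t : ℝ) : ℝ :=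
  ((L : ℝ) ^ 2)⁻¹ * ∑ j ∈ Finset.range L, ∑ k ∈ Finset.range L,
    if (j = 0 ∨ j = L - 1) ∧ k = 0 then 0 else
      (2 * Real.cos (Real.pi / L) * (Real.cos (Real.pi / L) - Real.cos ((2 * j + 1) * Real.pi / L))
        + 2 * (1 - Real.cos (2 * Real.pi * k / L)) - t)⁻¹

/-- **XY-POINT SCREENING INEQUALITY (first analytic lemma of GM₂, endpoint form, at `Δ = 0`):**
`g₁(L; 1/(L² g₀(L; 0))) ≤ 2 · g₀(L; 0)` for every `L ≥ 3`.  Via memo §220 it implies `γ₂(0, L) ≥ 1 − cos(2π/L)` (the XY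
two-magnon gap dominates the SEP gap).  [conjecture: theory seat hubbard-h0-rotor-theory-1, cycle 18, memo §220–§221;
numerically `g₁(τ₀)/g₀(0) ≤ 1.33` for `3 ≤ L ≤ 512` (kit j326114, limit `1`); analytic for `L ≥ L₀` by the pairing
`2c·a'_j ≥ c·(2a_j)·sin((j+1)π/L)/sin(jπ/L)` of twisted and periodic momenta (memo §221(c)); OPEN as a Lean theorem] -/
@[conjecture] def XYTwoMagnonScreening : Prop :=
  ∀ L : ℕ, 3 ≤ L → gOne L (1 / ((L : ℝ) ^ 2 * gZero L 0)) ≤ 2 * gZero L 0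

/-- [THEOREM on paper for `Δ ∈ [-1,0]` as well (memo 18 §226: LEMMA N1 level structure by min–max/interlacing,
LEMMA N2 `t₀ ≤ 12/(L²−5) ≤ ε₁`, PROP N3 p-channel Cauchy–Schwarz minorant; interval-certified `3 ≤ L ≤ 48`,
closed-form tail `B(L) > 0` for `L ≥ 32`); stated here as a Prop] Two-magnon END on the SYMMETRIC range
`Δ ∈ [-1,1]`: `γ₂(Δ, L) ≥ 1 − cos(2π/L)`, with equality iff `Δ = 1`.  Numerically it persists for every `Δ ≤ 1`
when `L ≥ 4`, but FAILS at `L = 3` for `Δ ≲ −6` (the `(1,1)`-sector level overtakes; memo §226(e)). -/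
@[conjecture] def TwoMagnonGapDominatesFerroSym : Prop :=
  ∀ L : ℕ, 3 ≤ L → ∀ [NeZero L], ∀ Δ : ℝ, -1 ≤ Δ → Δ ≤ 1 →
    SectorGapAtLeast L Δ (twoMagnonM L) (oneMagnonGap L)

/-- The symmetric-range statement restricts to the `[0,1]` statement `TwoMagnonGapDominatesFerro`. -/
theorem twoMagnonGapDominatesFerro_of_sym (h : TwoMagnonGapDominatesFerroSym) :
    TwoMagnonGapDominatesFerro :=
  fun L hL _ Δ h0 h1 => h L hL Δ (by linarith) h1

end Summit.HubbardSuperconductivity.HubbardSuperconductivity.Theorems.AnisotropyChord.Transfer
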